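import Summits.Ventures.PercRepro.RankLevelSetBasisDeviceA

/-!
# PercRepro — THE BASIS DEVICE, PART B: THE RANK-`q` SETS BY THE FLATS THEY SPAN (p8 g10, S3)

`proofs/SUBCLAIM-S3-p8.md` §3x. Every rank-`q` set `B` lies in the flat `F = cl(B)` (`≥ q` points); if `|F| ≤ t` and
`|B| ≤ c` then `B` is one of the `Σ_{i ∈ [q, c]} C(|F|, i)` subsets of `F` of that size (`card_lightF_le_sum`). An
independent `q`-subset of a rank-`q` flat spans it (`closF_eq_of_mem_indepF`), so the independent `q`-subsets of
distinct rank-`q` flats are distinct and number at most `C(n, q)` in all (`sum_card_indepF_flats_le`). With Part A's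
greedy count, `card_lightF_le` / **`ncard_eRk_eq_ncard_le_closure_le_le`**: if
`q!·Σ_{i ∈ [q, c]} C(m, i) ≤ G·∏_{k < q} max(m − f k, 1)` for every `q ≤ m ≤ t`, then
`#{B ⊆ E : r(B) = q, |B| ≤ c, |cl B| ≤ t} ≤ G·C(n, q)`. At level `6` on the `e`-free core (`f = 0, 1, 3, 6, 10, 19`,
the tree's flat caps) this replaces the pair count of the LIGHT class of the heavy / light split. Axioms: standard.
-/

open scoped Matroid

namespace PercRepro

namespace Matroid

open Set Finset

variable {α : Type} {M : _root_.Matroid α}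

/-- The closure of a finset as a finset. -/
noncomputable def closF (M : _root_.Matroid α) [M.Finite] (I : Finset α) : Finset α :=
  (M.ground_finite.subset (M.closure_subset_ground (I : Set α))).toFinset

/-- `closF` as a set is the closure. -/
theorem coe_closF [M.Finite] (I : Finset α) : ((closF M I : Finset α) : Set α) = M.closure (I : Set α) :=
  Set.Finite.coe_toFinset _

/-- Membership in `closF`. -/
theorem mem_closF [M.Finite] {I : Finset α} {x : α} : x ∈ closF M I ↔ x ∈ M.closure (I : Set α) :=
  Set.Finite.mem_toFinset _

/-- `#closF I = |cl(I)|`. -/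
theorem card_closF [M.Finite] (I : Finset α) : (closF M I).card = (M.closure (I : Set α)).ncard := by
  rw [← coe_closF, Set.ncard_coe_finset]

/-- `closF I ⊆ E`. -/
theorem closF_subset_ground [M.Finite] (I : Finset α) : closF M I ⊆ groundF M := by
  intro x hx
  rw [mem_closF] at hx
  rw [← Finset.mem_coe, coe_groundF]
  exact M.closure_subset_ground _ hx

open scoped Classical in
/-- The rank-`q` flats spanned by the independent `q`-subsets of the ground set. -/
noncomputable def flatsF (M : _root_.Matroid α) [M.Finite] (q : ℕ) : Finset (Finset α) :=
  (indepF M (groundF M) q).image (closF M)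

open scoped Classical in
/-- **An independent `q`-subset of a rank-`q` flat spans it**: for `I₀` independent with `q` elements and
`J ⊆ cl(I₀)` independent with `q` elements, `cl(J) = cl(I₀)`. -/
theorem closF_eq_of_mem_indepF [M.Finite] (q : ℕ) (I₀ J : Finset α) (hI₀ : I₀ ∈ indepF M (groundF M) q)
    (hJ : J ∈ indepF M (closF M I₀) q) : closF M J = closF M I₀ := by
  obtain ⟨hI₀g, hI₀c, hI₀ind⟩ := mem_indepF.1 hI₀
  obtain ⟨hJF, hJc, hJind⟩ := mem_indepF.1 hJ
  have hJcl : (J : Set α) ⊆ M.closure (I₀ : Set α) := by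
    rw [← coe_closF]; exact Finset.coe_subset.2 hJF
  unfold closF
  rw [Set.Finite.toFinset_inj]
  refine subset_antisymm (M.closure_subset_closure_of_subset_closure hJcl) ?_
  intro x hx
  by_contra hxJ
  have hxE : x ∈ M.E := M.closure_subset_ground _ hx
  have hxJ' : x ∉ (J : Set α) := fun h => hxJ (M.subset_closure _ hJind.subset_ground h)
  have hind : M.Indep (insert x (J : Set α)) :=
    (hJind.insert_indep_iff_of_notMem hxJ').2 ⟨hxE, hxJ⟩
  have hsub : insert x (J : Set α) ⊆ M.closure (I₀ : Set α) := Set.insert_subset hx hJcl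
  have h1 : M.eRk (insert x (J : Set α)) ≤ M.eRk (M.closure (I₀ : Set α)) := M.eRk_mono hsub
  rw [M.eRk_closure_eq, hI₀ind.eRk_eq_encard, Set.encard_coe_eq_coe_finsetCard, hI₀c, hind.eRk_eq_encard,
    Set.encard_insert_of_notMem hxJ', Set.encard_coe_eq_coe_finsetCard, hJc] at h1
  have h2 : q + 1 ≤ q := by exact_mod_cast h1
  omega

open scoped Classical in
/-- **The independent `q`-subsets of the rank-`q` flats are distinct**: `Σ_{F ∈ flatsF} #indepF F q ≤ C(n, q)`. -/
theorem sum_card_indepF_flats_le [M.Finite] (q : ℕ) :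
    ∑ F ∈ flatsF M q, (indepF M F q).card ≤ (M.E.ncard).choose q := by
  have hmaps : ∀ I ∈ indepF M (groundF M) q, closF M I ∈ flatsF M q :=
    fun I hI => Finset.mem_image_of_mem _ hI
  have hfib := Finset.card_eq_sum_card_fiberwise (f := closF M) (s := indepF M (groundF M) q) (t := flatsF M q) hmaps
  have hle : ∀ F ∈ flatsF M q, (indepF M F q).card ≤
      ((indepF M (groundF M) q).filter (fun I => closF M I = F)).card := by
    intro F hF
    unfold flatsF at hF
    rw [Finset.mem_image] at hF
    obtain ⟨I₀, hI₀, rfl⟩ := hF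
    apply Finset.card_le_card
    intro J hJ
    rw [Finset.mem_filter]
    refine ⟨?_, closF_eq_of_mem_indepF q I₀ J hI₀ hJ⟩
    obtain ⟨hJF, hJc, hJind⟩ := mem_indepF.1 hJ
    exact mem_indepF.2 ⟨hJF.trans (closF_subset_ground I₀), hJc, hJind⟩
  calc ∑ F ∈ flatsF M q, (indepF M F q).card
      ≤ ∑ F ∈ flatsF M q, ((indepF M (groundF M) q).filter (fun I => closF M I = F)).card :=
        Finset.sum_le_sum hle
    _ = (indepF M (groundF M) q).card := hfib.symm
    _ ≤ (groundF M).card.choose q := card_indepF_le_choose _ _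
    _ = (M.E.ncard).choose q := by rw [card_groundF]

open scoped Classical in
/-- The LIGHT rank-`q` sets as finsets: subsets of the ground set of rank `q`, at most `c` elements, closure of at most
`t` points. -/
noncomputable def lightF (M : _root_.Matroid α) [M.Finite] (q c t : ℕ) : Finset (Finset α) :=
  ((groundF M).powerset).filter (fun B => M.eRk (B : Set α) = (q : ℕ∞) ∧ B.card ≤ c ∧ (closF M B).card ≤ t)

open scoped Classical in
/-- Membership in `lightF`. -/
theorem mem_lightF [M.Finite] {q c t : ℕ} {B : Finset α} :
    B ∈ lightF M q c t ↔ B ⊆ groundF M ∧ M.eRk (B : Set α) = (q : ℕ∞) ∧ B.card ≤ c ∧ (closF M B).card ≤ t := by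
  unfold lightF
  rw [Finset.mem_filter, Finset.mem_powerset]

open scoped Classical in
/-- A rank-`q` finset `B` has its closure in `flatsF M q` (the closure of a basis of `B`). -/
theorem closF_mem_flatsF [M.Finite] (q : ℕ) (B : Finset α) (hBg : B ⊆ groundF M)
    (hBq : M.eRk (B : Set α) = (q : ℕ∞)) : closF M B ∈ flatsF M q := by
  have hBE : (B : Set α) ⊆ M.E := by rw [← coe_groundF]; exact Finset.coe_subset.2 hBg
  obtain ⟨I, hI⟩ := M.exists_isBasis (B : Set α) hBE
  have hIfin : I.Finite := B.finite_toSet.subset hI.subset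
  set If : Finset α := hIfin.toFinset with hIf
  have hIfc : (If : Set α) = I := Set.Finite.coe_toFinset _
  have hIcard : If.card = q := by
    have h1 := hI.encard_eq_eRk
    rw [hBq, ← hIfc, Set.encard_coe_eq_coe_finsetCard] at h1
    exact_mod_cast h1
  have hIfmem : If ∈ indepF M (groundF M) q := by
    rw [mem_indepF]
    refine ⟨?_, hIcard, by rw [hIfc]; exact hI.indep⟩
    intro x hx
    rw [← Finset.mem_coe, hIfc] at hx
    rw [← Finset.mem_coe, coe_groundF]
    exact hBE (hI.subset hx)
  have hcl : closF M If = closF M B := by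
    unfold closF
    rw [Set.Finite.toFinset_inj, hIfc]
    exact hI.closure_eq_closure
  unfold flatsF
  rw [Finset.mem_image]
  exact ⟨If, hIfmem, hcl⟩

open scoped Classical in
/-- **The light sets are subsets of small flats**: `#lightF ≤ Σ_{F ∈ flatsF, |F| ≤ t} Σ_{i ∈ [q, c]} C(|F|, i)`. -/
theorem card_lightF_le_sum [M.Finite] (q c t : ℕ) :
    (lightF M q c t).card ≤
      ∑ F ∈ (flatsF M q).filter (fun F => F.card ≤ t), ∑ i ∈ Finset.Icc q c, F.card.choose i := by
  have hsub : lightF M q c t ⊆ ((flatsF M q).filter (fun F => F.card ≤ t)).biUnion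
      (fun F => (Finset.Icc q c).biUnion (fun i => F.powersetCard i)) := by
    intro B hB
    obtain ⟨hBg, hBq, hBc, hBt⟩ := mem_lightF.1 hB
    rw [Finset.mem_biUnion]
    refine ⟨closF M B, ?_, ?_⟩
    · rw [Finset.mem_filter]
      exact ⟨closF_mem_flatsF q B hBg hBq, hBt⟩
    · rw [Finset.mem_biUnion]
      refine ⟨B.card, ?_, ?_⟩
      · rw [Finset.mem_Icc]
        refine ⟨?_, hBc⟩
        have h1 := M.eRk_le_encard (B : Set α)
        rw [hBq, Set.encard_coe_eq_coe_finsetCard] at h1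
        exact_mod_cast h1
      · rw [Finset.mem_powersetCard]
        refine ⟨?_, rfl⟩
        intro x hx
        rw [mem_closF]
        have hBE : (B : Set α) ⊆ M.E := by rw [← coe_groundF]; exact Finset.coe_subset.2 hBg
        exact M.subset_closure _ hBE (Finset.mem_coe.2 hx)
  calc (lightF M q c t).card ≤ _ := Finset.card_le_card hsub
    _ ≤ ∑ F ∈ (flatsF M q).filter (fun F => F.card ≤ t), ((Finset.Icc q c).biUnion (fun i => F.powersetCard i)).card :=
        Finset.card_biUnion_le
    _ ≤ ∑ F ∈ (flatsF M q).filter (fun F => F.card ≤ t), ∑ i ∈ Finset.Icc q c, F.card.choose i := by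
        apply Finset.sum_le_sum
        intro F _
        calc ((Finset.Icc q c).biUnion (fun i => F.powersetCard i)).card
            ≤ ∑ i ∈ Finset.Icc q c, (F.powersetCard i).card := Finset.card_biUnion_le
          _ = ∑ i ∈ Finset.Icc q c, F.card.choose i := by
              apply Finset.sum_congr rfl
              intro i _
              exact Finset.card_powersetCard i F

open scoped Classical in
/-- Every flat of `flatsF M q` has rank `q`, lies in the ground set and has at least `q` points. -/
theorem flatsF_props [M.Finite] (q : ℕ) (F : Finset α) (hF : F ∈ flatsF M q) :
    (F : Set α) ⊆ M.E ∧ M.eRk (F : Set α) = q ∧ q ≤ F.card := by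
  unfold flatsF at hF
  rw [Finset.mem_image] at hF
  obtain ⟨I, hI, rfl⟩ := hF
  obtain ⟨hIg, hIc, hIind⟩ := mem_indepF.1 hI
  refine ⟨by rw [coe_closF]; exact M.closure_subset_ground _, ?_, ?_⟩
  · rw [coe_closF, M.eRk_closure_eq, hIind.eRk_eq_encard, Set.encard_coe_eq_coe_finsetCard, hIc]
  · rw [← hIc]
    apply Finset.card_le_card
    intro x hx
    rw [mem_closF]
    exact M.subset_closure _ hIind.subset_ground (Finset.mem_coe.2 hx)

open scoped Classical in
/-- **THE BASIS DEVICE** (finset form): if `q!·Σ_{i ∈ [q, c]} C(m, i) ≤ G·∏_{k < q} max(m − f k, 1)` for every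
`q ≤ m ≤ t`, where sets of rank `≤ k < q` have at most `f k` points, then `#lightF M q c t ≤ G·C(n, q)`. -/
theorem card_lightF_le [M.Finite] (q c t : ℕ) (f : ℕ → ℕ)
    (hf : ∀ i < q, ∀ X ⊆ M.E, M.eRk X ≤ i → X.ncard ≤ f i) (G : ℚ) (hG0 : 0 ≤ G)
    (hG : ∀ m, q ≤ m → m ≤ t →
      ((q.factorial : ℕ) : ℚ) * (∑ i ∈ Finset.Icc q c, ((m.choose i : ℕ) : ℚ)) ≤
        G * ((∏ k ∈ Finset.range q, max (m - f k) 1 : ℕ) : ℚ)) :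
    ((lightF M q c t).card : ℚ) ≤ G * (((M.E.ncard).choose q : ℕ) : ℚ) := by
  have hfact : (0 : ℚ) < ((q.factorial : ℕ) : ℚ) := by exact_mod_cast Nat.factorial_pos q
  have h1 : ((lightF M q c t).card : ℚ) ≤
      ∑ F ∈ (flatsF M q).filter (fun F => F.card ≤ t), ∑ i ∈ Finset.Icc q c, ((F.card.choose i : ℕ) : ℚ) := by
    have := card_lightF_le_sum (M := M) q c t
    exact_mod_cast this
  -- per flat: `q!·Σ_i C(|F|, i) ≤ G·∏ ≤ G·q!·#indepF F q`
  have h2 : ∀ F ∈ (flatsF M q).filter (fun F => F.card ≤ t),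
      ((q.factorial : ℕ) : ℚ) * ∑ i ∈ Finset.Icc q c, ((F.card.choose i : ℕ) : ℚ) ≤
        ((q.factorial : ℕ) : ℚ) * (G * ((indepF M F q).card : ℚ)) := by
    intro F hF
    rw [Finset.mem_filter] at hF
    obtain ⟨hFE, hFq, hqF⟩ := flatsF_props q F hF.1
    have hg := factorial_mul_card_indepF_ge F hFE q hFq f hf q le_rfl
    have hgq : ((∏ k ∈ Finset.range q, max (F.card - f k) 1 : ℕ) : ℚ) ≤
        ((q.factorial : ℕ) : ℚ) * ((indepF M F q).card : ℚ) := by exact_mod_cast hg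
    calc ((q.factorial : ℕ) : ℚ) * ∑ i ∈ Finset.Icc q c, ((F.card.choose i : ℕ) : ℚ)
        ≤ G * ((∏ k ∈ Finset.range q, max (F.card - f k) 1 : ℕ) : ℚ) := hG F.card hqF hF.2
      _ ≤ G * (((q.factorial : ℕ) : ℚ) * ((indepF M F q).card : ℚ)) := mul_le_mul_of_nonneg_left hgq hG0
      _ = ((q.factorial : ℕ) : ℚ) * (G * ((indepF M F q).card : ℚ)) := by ring
  have h3 : ∑ F ∈ (flatsF M q).filter (fun F => F.card ≤ t), ((indepF M F q).card : ℚ) ≤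
      (((M.E.ncard).choose q : ℕ) : ℚ) := by
    have hs : ∑ F ∈ (flatsF M q).filter (fun F => F.card ≤ t), (indepF M F q).card ≤
        ∑ F ∈ flatsF M q, (indepF M F q).card :=
      Finset.sum_le_sum_of_subset_of_nonneg (Finset.filter_subset _ _) (fun _ _ _ => Nat.zero_le _)
    have := hs.trans (sum_card_indepF_flats_le (M := M) q)
    exact_mod_cast this
  have h4 : ((q.factorial : ℕ) : ℚ) * ((lightF M q c t).card : ℚ) ≤
      ((q.factorial : ℕ) : ℚ) * (G * (((M.E.ncard).choose q : ℕ) : ℚ)) := by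
    calc ((q.factorial : ℕ) : ℚ) * ((lightF M q c t).card : ℚ)
        ≤ ((q.factorial : ℕ) : ℚ) *
            ∑ F ∈ (flatsF M q).filter (fun F => F.card ≤ t), ∑ i ∈ Finset.Icc q c, ((F.card.choose i : ℕ) : ℚ) :=
          mul_le_mul_of_nonneg_left h1 hfact.le
      _ = ∑ F ∈ (flatsF M q).filter (fun F => F.card ≤ t),
            ((q.factorial : ℕ) : ℚ) * ∑ i ∈ Finset.Icc q c, ((F.card.choose i : ℕ) : ℚ) := by
          rw [Finset.mul_sum]
      _ ≤ ∑ F ∈ (flatsF M q).filter (fun F => F.card ≤ t),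
            ((q.factorial : ℕ) : ℚ) * (G * ((indepF M F q).card : ℚ)) := Finset.sum_le_sum h2
      _ = ((q.factorial : ℕ) : ℚ) * G *
            ∑ F ∈ (flatsF M q).filter (fun F => F.card ≤ t), ((indepF M F q).card : ℚ) := by
          rw [Finset.mul_sum]
          apply Finset.sum_congr rfl
          intro F _
          ring
      _ ≤ ((q.factorial : ℕ) : ℚ) * G * (((M.E.ncard).choose q : ℕ) : ℚ) :=
          mul_le_mul_of_nonneg_left h3 (mul_nonneg hfact.le hG0)
      _ = ((q.factorial : ℕ) : ℚ) * (G * (((M.E.ncard).choose q : ℕ) : ℚ)) := by ring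
  exact le_of_mul_le_mul_left h4 hfact

open scoped Classical in
/-- The set-builder count equals the finset count. -/
theorem ncard_light_eq_card_lightF [M.Finite] (q c t : ℕ) :
    {B : Set α | B ⊆ M.E ∧ M.eRk B = (q : ℕ∞) ∧ B.ncard ≤ c ∧ (M.closure B).ncard ≤ t}.ncard =
      (lightF M q c t).card := by
  set T := lightF M q c t with hT
  have himg : ((T.image (fun s : Finset α => (s : Set α)) : Finset (Set α)) : Set (Set α)) =
      {B : Set α | B ⊆ M.E ∧ M.eRk B = (q : ℕ∞) ∧ B.ncard ≤ c ∧ (M.closure B).ncard ≤ t} := by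
    ext B
    rw [Finset.mem_coe, Finset.mem_image, Set.mem_setOf_eq]
    constructor
    · rintro ⟨s, hs, rfl⟩
      obtain ⟨hsg, hsq, hsc, hst⟩ := mem_lightF.1 hs
      refine ⟨by rw [← coe_groundF]; exact Finset.coe_subset.2 hsg, hsq, by rw [Set.ncard_coe_finset]; exact hsc, ?_⟩
      rw [← card_closF]; exact hst
    · rintro ⟨hBE, hBq, hBc, hBt⟩
      have hBfin : B.Finite := M.ground_finite.subset hBE
      refine ⟨hBfin.toFinset, ?_, hBfin.coe_toFinset⟩
      rw [mem_lightF]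
      refine ⟨?_, by rw [hBfin.coe_toFinset]; exact hBq, ?_, ?_⟩
      · intro x hx
        rw [Set.Finite.mem_toFinset] at hx
        rw [← Finset.mem_coe, coe_groundF]
        exact hBE hx
      · rw [← Set.ncard_coe_finset, hBfin.coe_toFinset]; exact hBc
      · rw [card_closF, hBfin.coe_toFinset]; exact hBt
  rw [← himg, Set.ncard_coe_finset, Finset.card_image_of_injective _ Finset.coe_injective]

/-- **THE BASIS DEVICE**: `#{B ⊆ E : r(B) = q, |B| ≤ c, |cl B| ≤ t} ≤ G·C(n, q)` whenever
`q!·Σ_{i ∈ [q, c]} C(m, i) ≤ G·∏_{k < q} max(m − f k, 1)` for every `q ≤ m ≤ t`, the sets of rank `≤ k < q` having at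
most `f k` points. -/
theorem ncard_eRk_eq_ncard_le_closure_le_le [M.Finite] (q c t : ℕ) (f : ℕ → ℕ)
    (hf : ∀ i < q, ∀ X ⊆ M.E, M.eRk X ≤ i → X.ncard ≤ f i) (G : ℚ) (hG0 : 0 ≤ G)
    (hG : ∀ m, q ≤ m → m ≤ t →
      ((q.factorial : ℕ) : ℚ) * (∑ i ∈ Finset.Icc q c, ((m.choose i : ℕ) : ℚ)) ≤
        G * ((∏ k ∈ Finset.range q, max (m - f k) 1 : ℕ) : ℚ)) :
    ({B : Set α | B ⊆ M.E ∧ M.eRk B = (q : ℕ∞) ∧ B.ncard ≤ c ∧ (M.closure B).ncard ≤ t}.ncard : ℚ) ≤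
      G * (((M.E.ncard).choose q : ℕ) : ℚ) := by
  classical
  rw [ncard_light_eq_card_lightF]
  exact card_lightF_le q c t f hf G hG0 hG

end Matroid

end PercRepro
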